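import Summits.KontsevichZagierPeriods.KontsevichZagierPeriods.Theorems.RootDecompRelativeModAbsoluteRegFoldingDegOneP13
import Summits.KontsevichZagierPeriods.KontsevichZagierPeriods.Theses.RootDecompRelativeModAbsolute

/-!
# `RegFoldingDegOne` (route `RootDecompRelativeModAbsolute`, support item stmt-KontsevichZagierPeriods-30571) — PROVED · part 14/14

Cell `decomp-kz`, lens 3 (decomp-kz-lens-3 g9): `regFoldingDegOne_holds :
Theses.RootDecompRelativeModAbsolute.RegFoldingDegOne` BY NAME (in part 14/14) — every Kontsevich–Zagier
integral representation on `ℝ²` whose integrand is a quotient `p/q` of `ℚ`-polynomials with `deg_t q ≤ 1`,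
`q ≠ 0` on the domain, is equivalent in `KZ.relations` to `[g] + Σᵢ [Uᵢ]`, the `Uᵢ` honest 2-cells
`[g.domain × (0,1), hᵢ(x) θ^{Mᵢ}/(1 + θ^{eᵢ} κᵢ(x))]` (unfolded REGULARISED log/arctan monomials), with the
fibre integrals matching a.e.  Architecture: §1–§2 regularised terms `RTerm`, `RegFolding d`; §7 a.e.-congruence;
§8 gluing (`FoldsTo`); §9 one-band toolkit; §P analytic core (kernel independence); §10 cylinders; §11 affine band
chart; §13 `RegFolding 1` from a CAD band cover a.e. + vanishing on unbounded bands; last part: the edge to the born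
item text and `regFoldingDegOne_holds`.

Source: `HOME/decomp-kz-lens-3/g9/landing/RootDecompRelativeModAbsoluteRegFoldingDegOne.lean` sha256 60038aa44a5f6303
(4275 l; critic decomp-kz-crit-1 g2 CLEARED/kernel-confirmed 2026-08-30T09:41:19Z, std axioms), split mechanically
into 14 modules ≤ 400 lines by the landing seat decomp-kz-census-1 g7 (contexts re-opened per part; generic docstrings
added where the source had none; parts 1–13 do not import the route file).  No `sorry`; standard axioms.
References: [cite: KontsevichZagier2001, §1.2]; Basu–Pollack–Roy 2006 Def. 5.1 / Cor. 5.7; Bochnak–Coste–Roy 1998 §2.9.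
-/

noncomputable section

open Set MeasureTheory Filter Topology
open scoped BigOperators
open Literature.NumberTheory.Transcendental Literature.ModelTheory.ExponentialFields

open Summit.KontsevichZagierPeriods.KontsevichZagierPeriods.Theses.RootDecompRelativeModAbsolute

namespace Summit.KontsevichZagierPeriods.RootDecompRelativeModAbsolute.Rung30571

namespace RegularisedLogLayer

section Vanish

variable {b : ℕ}

/-- **Piece 2 PROVED.** -/
theorem unboundedBandVanish (b : ℕ) : UnboundedBandVanish b := by
  intro r G l ξ j hreg hj hdom n p q₀ q₁ hqne hint
  have hDm : MeasurableSet r.domain := KZ.IntegralRep.measurableSet_domain_holds r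
  have hI : Integrable (r.domain.indicator r.integrand) :=
    (integrable_indicator_iff hDm).2 r.integrableOn
  have hfib := ae_integrable_snoc hI
  -- fibrewise vanishing
  have hx : ∀ᵐ x : (Fin b → ℝ), ∀ t : ℝ, (Fin.snoc x t : Fin (b + 1) → ℝ) ∈ r.domain →
      r.integrand (Fin.snoc x t) = 0 := by
    filter_upwards [hfib] with x hxI
    intro t ht
    have hxG : x ∈ G := by
      rw [hdom] at ht
      exact (snoc_mem_bandOver_iff.1 ht).1
    set F : Set ℝ := {t | (Fin.snoc x t : Fin (b + 1) → ℝ) ∈ r.domain} with hF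
    have hFm : MeasurableSet F := hDm.preimage (measurable_snoc x)
    have hFi : IntegrableOn (fun t => r.integrand (Fin.snoc x t)) F := by
      rw [← integrable_indicator_iff hFm]
      refine hxI.congr (ae_of_all _ fun s => ?_)
      rw [show (fun t => r.integrand (Fin.snoc x t)) = r.integrand ∘ Fin.snoc x from rfl,
        show F = Fin.snoc x ⁻¹' r.domain from rfl, Set.indicator_comp_right]
    -- the fibre integrand is `P(t)/(q₀ x + q₁ x · t)`
    set P : Polynomial ℝ := ∑ i ∈ Finset.range (n + 1),
      Polynomial.C (p i x) * Polynomial.X ^ i with hP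
    have hPev : ∀ s, P.eval s = ∑ i ∈ Finset.range (n + 1), p i x * s ^ i := fun s => by
      simp [hP, Polynomial.eval_finsetSum]
    have hform : ∀ s ∈ F, r.integrand (Fin.snoc x s) = P.eval s / (q₀ x + q₁ x * s) :=
      fun s hs => by
      rw [hint hs, hPev]
      simp
    have hneF : ∀ s ∈ F, q₀ x + q₁ x * s ≠ 0 := fun s hs => by simpa using hqne _ hs
    have hFeq : F = {s : ℝ | bandLower ξ j x < (s : EReal) ∧ (s : EReal) < bandUpper ξ j x} := by
      ext s
      simp only [hF, mem_setOf_eq, hdom, snoc_mem_bandOver_iff, hxG, true_and]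
    -- a ray inside the fibre, and the core lemma
    have hP0 : P = 0 := by
      rcases hj with hj | hj
      · subst hj
        obtain ⟨q, -, hq⟩ := EReal.exists_rat_btwn_of_lt
          (bot_lt_iff_ne_bot.2 (bandUpper_ne_bot ξ 0 x))
        have hc : Iio (q : ℝ) ⊆ F := fun s hs => by
          rw [hFeq]
          refine ⟨by simp, lt_trans ?_ hq⟩
          exact_mod_cast hs
        exact poly_eq_zero_of_integrableOn_Iio P (q₀ x) (q₁ x) q (fun s hs => hneF s (hc hs))
          ((hFi.mono_set hc).congr_fun (fun s hs => hform s (hc hs)) measurableSet_Iio)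
      · subst hj
        obtain ⟨q, hq, -⟩ := EReal.exists_rat_btwn_of_lt
          (lt_top_iff_ne_top.2 (bandLower_ne_top ξ (Fin.last l) x))
        have hc : Ioi (q : ℝ) ⊆ F := fun s hs => by
          rw [hFeq]
          refine ⟨lt_trans hq ?_, by simp⟩
          exact_mod_cast hs
        exact poly_eq_zero_of_integrableOn_Ioi P (q₀ x) (q₁ x) q (fun s hs => hneF s (hc hs))
          ((hFi.mono_set hc).congr_fun (fun s hs => hform s (hc hs)) measurableSet_Ioi)
    rw [hform t ht, hP0, Polynomial.eval_zero, zero_div]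
  -- from the fibres to the total space
  rw [ae_iff] at hx ⊢
  refine measure_mono_null (fun z hz => ?_) (KZ.volume_setOf_init_mem_eq_zero hx)
  simp only [mem_setOf_eq, not_forall] at hz ⊢
  obtain ⟨hzD, hfz⟩ := hz
  exact ⟨z (Fin.last b), by rw [Fin.snoc_init_self]; exact hzD,
    by rw [Fin.snoc_init_self]; exact hfz⟩

end Vanish

/-! ### §13.4 Piece 1 PROVED for `b = 1`: the regular band cover from CAD -/

section Cover

variable {b : ℕ}

/-- `bandOver_mono`: auxiliary theorem of the `RegFoldingDegOne` (stmt-30571) development — see the module docstring; statement and proof verbatim from the lens-3 g9 landing file. -/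
private theorem bandOver_mono {l : ℕ} {S S' : Set (Fin b → ℝ)} (h : S' ⊆ S)
    (ξ : Fin l → (Fin b → ℝ) → ℝ) (j : Fin (l + 1)) : bandOver S' ξ j ⊆ bandOver S ξ j := by
  intro z hz
  rw [mem_bandOver_iff] at hz ⊢
  exact ⟨h hz.1, hz.2⟩

/-- Distinct bands over one base with strictly ordered sections are disjoint.
[BPR 2006, Def. 5.1] -/
theorem bandOver_disjoint_of_lt {l : ℕ} {S : Set (Fin b → ℝ)} {ξ : Fin l → (Fin b → ℝ) → ℝ}
    (hmono : ∀ x ∈ S, StrictMono fun i => ξ i x) {j j' : Fin (l + 1)} (hjj : j < j') :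
    Disjoint (bandOver S ξ j) (bandOver S ξ j') := by
  rw [Set.disjoint_left]
  intro z hz hz'
  rw [mem_bandOver_iff] at hz hz'
  have hl : j ≠ Fin.last l := by
    rintro rfl
    exact absurd hjj (not_lt.2 (Fin.le_last j'))
  have h0 : j' ≠ 0 := by
    rintro rfl
    exact absurd hjj (not_lt.2 (Fin.zero_le j))
  have hjv : j.val < j'.val := Fin.lt_def.1 hjj
  rw [bandUpper_of_ne_last ξ j hl] at hz
  rw [bandLower_of_ne_zero ξ j' h0] at hz'
  have hle : ξ (j.castPred hl) (Fin.init z) ≤ ξ (j'.pred h0) (Fin.init z) := by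
    refine ((hmono _ hz.1).monotone (Fin.le_def.2 ?_))
    rw [Fin.coe_castPred, Fin.val_pred]
    omega
  have h1 := hz.2.2
  have h2 := hz'.2.1
  rw [EReal.coe_lt_coe_iff] at h1 h2
  linarith

set_option maxHeartbeats 800000 in
/-- **Piece 1 PROVED (`b = 1`).** Take the CAD of `ℝ²` adapted to `D`
(`IsSemialgebraic.exists_cylindricalDecomposition_holds`, via `exists_fibre_eq`); over each base cell
`S ⊆ ℝ¹` shrink to the open `ℚ`-semialgebraic full-measure locus `G_S ⊆ S` where all sections are
differentiable (`KZ.exists_isOpen_contDiffOn`); the pieces are the bands of `D` over the `G_S`. What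
is discarded — graphs of sections (`KZ.volume_graph_eq_zero`) and the cylinders over the null sets
`S \ G_S` (`KZ.volume_setOf_init_mem_eq_zero`) — is null. -/
theorem bandCoverAE_one : BandCoverAE 1 := by
  classical
  intro D hD
  obtain ⟨𝒮, l, ξ, h𝒮, -, hsa, hmono, -, hfib⟩ :=
    IsSemialgebraic.exists_cylindricalDecomposition.exists_fibre_eq
      IsSemialgebraic.exists_cylindricalDecomposition_holds hD
  have h𝒮sa := h𝒮.isSemialgebraic
  have h𝒮part := h𝒮.isPartition
  choose Gi Bi hGi hBi hfi using hfib
  -- full-measure open loci of regularity over each base cell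
  have hreg0 : ∀ S ∈ 𝒮, ∃ G : Set (Fin 1 → ℝ), G ⊆ S ∧ IsOpen G ∧ IsSemialgebraic ℚ G ∧
      volume (S \ G) = 0 := by
    intro S hS
    obtain ⟨G, hGS, hGo, hGsa, -, -, hnull⟩ :=
      KZ.exists_isOpen_contDiffOn (h𝒮sa S hS) (isSemialgebraicFunOn_ratCast (h𝒮sa S hS) 0)
    exact ⟨G, hGS, hGo, hGsa, hnull⟩
  choose G0 hG0S hG0o hG0sa hG0null using hreg0
  have hregi : ∀ S ∈ 𝒮, ∀ i : Fin (l S), ∃ G : Set (Fin 1 → ℝ), G ⊆ S ∧ IsOpen G ∧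
      IsSemialgebraic ℚ G ∧ DifferentiableOn ℝ (ξ S i) G ∧ volume (S \ G) = 0 := by
    intro S hS i
    obtain ⟨G, hGS, hGo, hGsa, hcd, -, hnull⟩ := KZ.exists_isOpen_contDiffOn (h𝒮sa S hS) (hsa S hS i)
    exact ⟨G, hGS, hGo, hGsa, hcd.differentiableOn (by simp), hnull⟩
  choose Gs hGsS hGso hGssa hGsd hGsnull using hregi
  -- the regular base `Gb S ⊆ S` (kept opaque behind the equation `hGb`)
  obtain ⟨Gb, hGb⟩ : ∃ Gb : (S : Set (Fin 1 → ℝ)) → S ∈ 𝒮 → Set (Fin 1 → ℝ),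
      Gb = fun S hS => G0 S hS ∩ ⋂ i, Gs S hS i := ⟨_, rfl⟩
  have hmemGb : ∀ S hS x, x ∈ Gb S hS ↔ x ∈ G0 S hS ∧ ∀ i, x ∈ Gs S hS i := by
    intro S hS x
    rw [hGb]
    simp only [mem_inter_iff, mem_iInter]
  have hGbS : ∀ S hS, Gb S hS ⊆ S := fun S hS x hx => hG0S S hS ((hmemGb S hS x).1 hx).1
  have hGbGs : ∀ S hS i, Gb S hS ⊆ Gs S hS i := fun S hS i x hx => ((hmemGb S hS x).1 hx).2 i
  have hGbo : ∀ S hS, IsOpen (Gb S hS) := by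
    intro S hS
    rw [hGb]
    exact (hG0o S hS).inter (isOpen_iInter_of_finite fun i => hGso S hS i)
  have hGbsa : ∀ S hS, IsSemialgebraic ℚ (Gb S hS) := by
    intro S hS
    have : Gb S hS = G0 S hS \ ⋃ i, (G0 S hS \ Gs S hS i) := by
      ext x
      rw [hmemGb]
      simp only [Set.mem_sdiff, mem_iUnion, not_exists, not_and, not_not]
      tauto
    rw [this]
    exact (hG0sa S hS).diff (isSemialgebraic_iUnion_fin fun i => (hG0sa S hS).diff (hGssa S hS i))
  have hGbnull : ∀ S hS, volume (S \ Gb S hS) = 0 := by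
    intro S hS
    have hsub : S \ Gb S hS ⊆ (S \ G0 S hS) ∪ ⋃ i, (S \ Gs S hS i) := by
      intro x hx
      rw [Set.mem_sdiff, hmemGb] at hx
      simp only [not_and, not_forall] at hx
      simp only [mem_union, Set.mem_sdiff, mem_iUnion]
      by_cases h0 : x ∈ G0 S hS
      · obtain ⟨i, hi⟩ := hx.2 h0
        exact Or.inr ⟨i, hx.1, hi⟩
      · exact Or.inl ⟨hx.1, h0⟩
    exact measure_mono_null hsub
      (measure_union_null (hG0null S hS) (measure_iUnion_null fun i => hGsnull S hS i))
  have hRS : ∀ S hS, RegularSections (Gb S hS) (ξ S) := fun S hS =>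
    { isOpen := hGbo S hS
      isSemialgebraic := hGbsa S hS
      sa := fun i => (hsa S hS i).mono (hGbS S hS) (hGbsa S hS)
      diff := fun i => (hGsd S hS i).mono (hGbGs S hS i)
      strictMono := fun x hx => hmono S hS x (hGbS S hS hx) }
  -- re-index the pieces `(S, j ∈ B_S)` by `Fin N`
  obtain ⟨N, ⟨e⟩⟩ : ∃ N, Nonempty (Fin N ≃ Σ S : ↥𝒮, ↥(Bi S.1 S.2)) :=
    ⟨_, ⟨(Fintype.equivFin (Σ S : ↥𝒮, ↥(Bi S.1 S.2))).symm⟩⟩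
  refine ⟨N, fun k => Gb (e k).1.1 (e k).1.2, fun k => l (e k).1.1, fun k => ξ (e k).1.1,
    fun k => ((e k).2 : Fin (l (e k).1.1 + 1)), fun k => hRS _ _, fun k => ?_,
    fun k k' hkk => ?_, ?_⟩
  · exact (bandOver_mono (hGbS _ _) _ _).trans (hBi _ _ _ (e k).2.2)
  · -- pairwise a.e.-disjointness (in fact disjointness)
    have hne : e k ≠ e k' := fun h => hkk (e.injective h)
    dsimp only
    rcases hk : e k with ⟨⟨S, hS⟩, ⟨j, hj⟩⟩
    rcases hk' : e k' with ⟨⟨S', hS'⟩, ⟨j', hj'⟩⟩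
    rw [hk, hk'] at hne
    by_cases hSS : S = S'
    · subst hSS
      have hjj : j ≠ j' := by
        rintro rfl
        exact hne rfl
      have hm : ∀ x ∈ Gb S hS, StrictMono fun i => ξ S i x := (hRS S hS).strictMono
      rcases lt_or_gt_of_ne hjj with h | h
      · rw [(bandOver_disjoint_of_lt hm h).inter_eq, measure_empty]
      · rw [Set.inter_comm, (bandOver_disjoint_of_lt hm h).inter_eq, measure_empty]
    · have hdj : Disjoint S S' :=
        h𝒮part.pairwiseDisjoint (Finset.mem_coe.2 hS) (Finset.mem_coe.2 hS') hSS
      have hdj' : Disjoint (bandOver (Gb S hS) (ξ S) j) (bandOver (Gb S' hS') (ξ S') j') :=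
        Set.disjoint_left.2 fun z hz hz' => Set.disjoint_left.1 hdj
          (hGbS S hS (mem_bandOver_iff.1 hz).1) (hGbS S' hS' (mem_bandOver_iff.1 hz').1)
      rw [hdj'.inter_eq, measure_empty]
  · -- the discarded set is null
    have hZ1 : volume (⋃ S : ↥𝒮, ⋃ i : Fin (l S.1), graphOver S.1 (ξ S.1 i)) = 0 :=
      measure_iUnion_null fun S => measure_iUnion_null fun i =>
        KZ.volume_graph_eq_zero (hsa S.1 S.2 i)
    have hZ2 : volume (⋃ S : ↥𝒮, {z : Fin (1 + 1) → ℝ | Fin.init z ∈ S.1 \ Gb S.1 S.2}) = 0 :=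
      measure_iUnion_null fun S => KZ.volume_setOf_init_mem_eq_zero (hGbnull S.1 S.2)
    refine measure_mono_null (fun z hz => ?_) (measure_union_null hZ1 hZ2)
    obtain ⟨hzD, hzU⟩ := hz
    obtain ⟨S, ⟨hS, hxS⟩, -⟩ := h𝒮part.2 (Fin.init z)
    have hS' : S ∈ 𝒮 := Finset.mem_coe.1 hS
    have ht : z (Fin.last 1) ∈ {t : ℝ | (Fin.snoc (Fin.init z) t : Fin (1 + 1) → ℝ) ∈ D} := by
      simp only [mem_setOf_eq, Fin.snoc_init_self]
      exact hzD
    rw [hfi S hS' (Fin.init z) hxS] at ht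
    simp only [mem_union, mem_iUnion, mem_singleton_iff, mem_setOf_eq, exists_prop] at ht
    rcases ht with ⟨i, -, hzi⟩ | ⟨j, hj, hlow, hup⟩
    · exact Or.inl (mem_iUnion.2 ⟨⟨S, hS'⟩, mem_iUnion.2 ⟨i, ⟨hxS, hzi⟩⟩⟩)
    · by_cases hxG : Fin.init z ∈ Gb S hS'
      · exfalso
        apply hzU
        refine mem_iUnion.2 ⟨e.symm ⟨⟨S, hS'⟩, ⟨j, hj⟩⟩, ?_⟩
        dsimp only
        rw [Equiv.apply_symm_apply]
        show z ∈ bandOver (Gb S hS') (ξ S) j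
        exact mem_bandOver_iff.2 ⟨hxG, hlow, hup⟩
      · exact Or.inr (mem_iUnion.2 ⟨⟨S, hS'⟩, ⟨hxS, hxG⟩⟩)

end Cover

/-! ### §13.5 CONCLUSION: `RegFolding 1`, hence the route support `RegFoldingDegOne` (30571) -/

/-- **`RegFolding 1` (PROVED).** Every KZ integrand on `ℝ²` that is rational with `t`-degree-`≤ 1`
denominator folds, fibrewise-exactly, to an admissible one-variable term of arctan/log layers. -/
theorem regFolding_one : RegFolding 1 :=
  regFolding_one_of_pieces bandCoverAE_one (unboundedBandVanish 1)

/-! ## §4 The edge from the structured form to the born item text (PROVED) -/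

/-- The structured folding gives the inline one. -/
theorem regFoldingDegOne_of_structured (hF : RegFolding 1) : RegFoldingDegOne := by
  intro r hr
  obtain ⟨T, hT, h1, h2⟩ := hF r hr
  exact ⟨RTerm.baseRep T hT, T.k, T.h, T.κ, T.M, T.e, RTerm.monomialRep T hT,
    hT.isSemialgebraicFunOn_h, hT.isSemialgebraicFunOn_κ, hT.e_mem, hT.neg_one_lt_κ, fun _ => rfl,
    fun _ _ _ => rfl, hT.integrableOn_monomial_base, h1, h2⟩

/-- **The route support statement `RegFoldingDegOne` (stmt-30571), PROVED.** -/
theorem regFoldingDegOne_holds : RegFoldingDegOne :=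
  regFoldingDegOne_of_structured regFolding_one

end RegularisedLogLayer

end Summit.KontsevichZagierPeriods.RootDecompRelativeModAbsolute.Rung30571

end
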